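import Summits.QuantumFields.BalabanUV.Beta.EriceRemainderEnclosureHistoryAutonomyThresholdModulus
import Summits.QuantumFields.BalabanUV.Beta.EriceRemainderEnclosureHistoryAutonomyThresholdModulusWitness
import Summits.QuantumFields.BalabanUV.Beta.EriceRemainderEnclosureHistoryAutonomyThresholdModulusShift
import Summits.QuantumFields.BalabanUV.Beta.EriceRemainderEnclosureHistoryAutonomyThresholdWitness

/-!
# EriceRemainderEnclosureHistoryAutonomyThresholdModulusExact — (E47c) THE MODULUS ACROSS THE THRESHOLD, PINCHED: (E47a)'s upper two-term modulus
# and (E47b)'s kink family side by side — for the Markov kink flow `κ_q` (`γ = 1`, `b = 2`, ratio `q ∈ [0,1]`), pins `1` and `p ∈ [1∕2, 1[`,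
# `P = 1∕p² − 1`: Lipschitz regime `P ≤ 9(1−q)²`: `P∕(68(1−q)) ≤ h(1) − h′(1) ≤ sup_j |h_j − h′_j| ≤ P∕(2(1−q))`; Hölder regime `9(1−q)² ≤ P`:
# `√P∕20 ≤ … ≤ √(P∕(2q))`; AT the threshold `q = 1`: `√P∕10 ≤ … ≤ √(P∕2)`; and the HÖLDER EXPONENT AT THE THRESHOLD IS EXACTLY `1∕2`: a uniform
# bound `h(1) − h′(1) ≤ K·P^α` over the pins `p ∈ [1∕2,1[` holds for SOME `K` if and only if `α ≤ 1∕2` (`hoelder_exponent_iff`)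

Cell `pub-balaban`, β-function sub-cell, BINDER row D4 «RemainderConst leaves for Bałaban's split» (`HOME/BINDER-OWNERS.md`; owner lineage `b2b-balaban-beta-an4`;
this file by co-owner #2 lineage `b2b-balaban-beta-d4-p2`, generation 42), β-FLOW TEAM duty (1), FREEZE (0) honoured (def-free; (E47a) `two_term_modulus_zs_closed` ∕
`abs_sub_le_two_regime` ∕ `abs_sub_le_sqrt_zs_closed`, (E47b) `zerothMoment_kink` ∕ `two_le_kink` ∕ `kink_ratio` ∕ `gap_*` ∕ `pin_of_forcing` ∕ `exists_solution`
BY NAME, (E47d) `shift_gap_at_threshold` BY NAME, nothing restated).  ENDs of the station (E47) = (E47a) `…ThresholdModulus` + (E47b) `…ThresholdModulusWitness`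
+ (E47d) `…ThresholdModulusShift` (all imported).

HONEST FRAMING (page 1, verbatim and binding).  *"Discharging BetaPertH makes Bałaban's UV stability UNCONDITIONAL — a real constructive-QFT result; it is
NOT the continuum limit and NOT the Clay problem."*  THIS FILE DISCHARGES NOTHING OF THE KIND.  Elementary real analysis on a kernel TOY family; which modulus
Bałaban's limit functional has and on which side of the threshold it sits is NOT PRINTED ([I] p. 298) and not asserted.  Row D4 class UNCHANGED (critical-path
width 0; instance 0∕1; D4 DISCHARGE NO DATE).  HONEST DEPENDENCY: continuum YM on T⁴ ⇐ BetaPertH ∧ nine spine estimates (0/9 proved); BetaPertH ⇐ (D1) ∧ (D4) ∧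
CAP+tail; G-an2-4 gates asym, D1 and NE2/3/4.

WHAT IS PROVED ([folklore]; 0 `def`, 0 sorry).  §1 (general, (E47a) read out): `abs_sub_le_of_pins` (`≤ γ³P + γ²√P`), `abs_sub_le_of_functionals`
(`≤ 2γη∕(3√3b) + √(2γ²η∕(3√3b))`), `tendsto_forcing`, **`tendstoUniformly_of_ratio_le`** (`B_n → B` uniformly on the box with common floor, pins `g_n → g_IR`,
`M·γ ≤ 3√3·b` ⟹ `TendstoUniformly h_n h atTop` — with a rate and WITHOUT (E40)'s common bound `U`).  §2 `abs_one_sub_inv_sq`, **`upper_two_term_kink`**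
((E47a) specialised: `(1−q)|h_j − h′_j| + q|h_j − h′_j|² ≤ P∕2`), `upper_lipschitz_kink` (`≤ P∕(2(1−q))`), `upper_sqrt_kink` (`≤ √(P∕(2q))`),
`upper_at_threshold_kink` (`≤ √(P∕2)`).  §3 **`pinched_lipschitz_regime`**, **`pinched_hoelder_regime`**, **`pinched_at_threshold`**, **`pinched_functional_at_threshold`**
((E47d)'s shift: `√η∕10 ≤ h(1) − h′(1)` ∧ `∀ j, |h_j − h′_j| ≤ √(η∕(6√3))`).  §4 **`not_hoelder_above_half`**
(`∀ K, ∀ α > 1∕2, ∃ p ∈ [1∕2,1[` and solutions with `h(1) − h′(1) > K·P^α`), `hoelder_below_half` (`α ≤ 1∕2 ⟹ h(1) − h′(1) ≤ 3^{1∕2−α}∕√2·P^α`),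
**`hoelder_exponent_iff`** (`(∃ K, uniform bound K·P^α) ↔ α ≤ 1∕2`).  §5 **`width_pinched_tent`** ((E47a)'s width bound `γ(1 − 1∕q)` against (E38c)'s tent:
`W_y∕3 ≤ |hSlow 1 − hF_y 1|` ∧ `sup_j |hSlow j − hF_y j| ≤ W_y`, `W_y = (1−y)(1+2y)∕(1+y)` — the linear rate of the width at `3√3` is exact).
-/

noncomputable section
open Filter Topology Finset

namespace Summit.QuantumFields.BalabanUV.Beta.EriceRemainderEnclosureHistoryAutonomyThresholdModulusExact

open Literature.MathematicalPhysics.QuantumFieldTheory.Balaban1983to89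
open Literature.MathematicalPhysics.QuantumFieldTheory.Balaban1983to89.T4BetaStationary
open Literature.MathematicalPhysics.QuantumFieldTheory.Balaban1983to89.T4BetaFlowWellPosed
open Summit.QuantumFields.BalabanUV.Beta.EriceRemainderEnclosureHistoryAutonomyThresholdModulus
open Summit.QuantumFields.BalabanUV.Beta.EriceRemainderEnclosureHistoryAutonomyThresholdModulusWitness
open Summit.QuantumFields.BalabanUV.Beta.EriceRemainderEnclosureHistoryAutonomyThresholdModulusShift (shift_gap_at_threshold)
open Literature.MathematicalPhysics.QuantumFieldTheory.Balaban1983to89.T4BetaFlowWellPosed.Sharpness (hSlow seqBox_hSlow)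
open Summit.QuantumFields.BalabanUV.Beta.EriceRemainderEnclosureHistoryAutonomyThresholdWitness
  (two_le_tentφ zerothMoment_tentφ sqrt3_mul_hSlow_one hF_succ seqBox_hF memFlow_hSlow_tentφ memFlow_hF_tentφ)

variable {B B' : (ℕ → ℝ) → ℝ} {M γ b η gIR gIR' q p : ℝ} {h h' : ℕ → ℝ}

/-! ## §1 (E47a) read in the pin alone, in the functional alone, and along a sequence of data -/

/-- THE PIN ALONE (one functional, `M·γ ≤ 3√3·b`, two pins): `|h_j − h′_j| ≤ γ³·P + γ²·√P`, `P = |1∕g_IR² − 1∕g_IR′²|` — `1∕2`-Hölder in the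
infrared datum `1∕g_IR²`, uniformly in the scale. [folklore] -/
theorem abs_sub_le_of_pins
    (hB : ∀ u u' : ℕ → ℝ, SeqBox γ u → SeqBox γ u' → ∀ D : ℝ, (∀ j, |u j - u' j| ≤ D) → |B u - B u'| ≤ M * D)
    (hM : 0 ≤ M) (hgIR : 0 < gIR) (hgIRγ : gIR ≤ γ) (hgIR' : 0 < gIR') (hgIR'γ : gIR' ≤ γ) (hb : 0 < b)
    (hlo : ∀ u, SeqBox γ u → b ≤ B u) (hsmall : M * γ ≤ 3 * Real.sqrt 3 * b) (hh : SeqBox γ h) (hh' : SeqBox γ h')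
    (hf : MemFlow B gIR h) (hf' : MemFlow B gIR' h') (j : ℕ) :
    |h j - h' j| ≤ γ ^ 3 * |1 / gIR ^ 2 - 1 / gIR' ^ 2| + γ ^ 2 * Real.sqrt |1 / gIR ^ 2 - 1 / gIR' ^ 2| := by
  have hγ : 0 < γ := lt_of_lt_of_le hgIR hgIRγ
  have h0 : ∀ u, SeqBox γ u → |B u - B u| ≤ 0 := fun u _ => by simp
  have := abs_sub_le_two_regime hB hM hgIR hgIRγ hgIR' hgIR'γ hb hlo hlo hsmall h0 hh hh' hf hf' j
  have e1 : 2 * (γ ^ 3 / 2 * |1 / gIR ^ 2 - 1 / gIR' ^ 2| + γ / (3 * Real.sqrt 3 * b) * 0)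
      = γ ^ 3 * |1 / gIR ^ 2 - 1 / gIR' ^ 2| := by ring
  have e2 : Real.sqrt (2 * γ * (γ ^ 3 / 2 * |1 / gIR ^ 2 - 1 / gIR' ^ 2| + γ / (3 * Real.sqrt 3 * b) * 0))
      = γ ^ 2 * Real.sqrt |1 / gIR ^ 2 - 1 / gIR' ^ 2| := by
    rw [show 2 * γ * (γ ^ 3 / 2 * |1 / gIR ^ 2 - 1 / gIR' ^ 2| + γ / (3 * Real.sqrt 3 * b) * 0)
        = (γ ^ 2) ^ 2 * |1 / gIR ^ 2 - 1 / gIR' ^ 2| by ring,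
      Real.sqrt_mul (by positivity), Real.sqrt_sq (by positivity)]
  rwa [e1, e2] at this

/-- THE FUNCTIONAL ALONE (one pin, `|B − B′| ≤ η` on the box, `M·γ ≤ 3√3·b` for `B`): `|h_j − h′_j| ≤ 2γη∕(3√3·b) + √(2γ²η∕(3√3·b))` —
`1∕2`-Hölder in the supremum distance of the functionals on the box. [folklore] -/
theorem abs_sub_le_of_functionals
    (hB : ∀ u u' : ℕ → ℝ, SeqBox γ u → SeqBox γ u' → ∀ D : ℝ, (∀ j, |u j - u' j| ≤ D) → |B u - B u'| ≤ M * D)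
    (hM : 0 ≤ M) (hgIR : 0 < gIR) (hgIRγ : gIR ≤ γ) (hb : 0 < b) (hlo : ∀ u, SeqBox γ u → b ≤ B u)
    (hlo' : ∀ u, SeqBox γ u → b ≤ B' u) (hsmall : M * γ ≤ 3 * Real.sqrt 3 * b) (hη : ∀ u, SeqBox γ u → |B u - B' u| ≤ η)
    (hh : SeqBox γ h) (hh' : SeqBox γ h') (hf : MemFlow B gIR h) (hf' : MemFlow B' gIR h') (j : ℕ) :
    |h j - h' j| ≤ 2 * (γ / (3 * Real.sqrt 3 * b) * η) + Real.sqrt (2 * γ * (γ / (3 * Real.sqrt 3 * b) * η)) := by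
  have := abs_sub_le_two_regime hB hM hgIR hgIRγ hgIR hgIRγ hb hlo hlo' hsmall hη hh hh' hf hf' j
  simpa only [sub_self, abs_zero, mul_zero, zero_add] using this


/-- The forcings of a convergent sequence of data vanish: pins `g_n → g_IR ≠ 0` and `η_n → 0` ⟹
`γ³∕2·|1∕g_n² − 1∕g_IR²| + γ∕(3√3·b)·η_n → 0`. [folklore] -/
theorem tendsto_forcing {g : ℕ → ℝ} {ηs : ℕ → ℝ} (hgIR : gIR ≠ 0) (hg : Tendsto g atTop (𝓝 gIR))
    (hηs : Tendsto ηs atTop (𝓝 0)) :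
    Tendsto (fun n => γ ^ 3 / 2 * |1 / g n ^ 2 - 1 / gIR ^ 2| + γ / (3 * Real.sqrt 3 * b) * ηs n) atTop (𝓝 0) := by
  have h1 : Tendsto (fun n => 1 / g n ^ 2) atTop (𝓝 (1 / gIR ^ 2)) :=
    tendsto_const_nhds.div (hg.pow 2) (pow_ne_zero 2 hgIR)
  have h2 : Tendsto (fun n => |1 / g n ^ 2 - 1 / gIR ^ 2|) atTop (𝓝 0) := by
    have := (h1.sub tendsto_const_nhds (b := 1 / gIR ^ 2)).abs
    simpa using this
  have := (h2.const_mul (γ ^ 3 / 2)).add (hηs.const_mul (γ / (3 * Real.sqrt 3 * b)))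
  simpa using this

/-- **UNIFORM CONVERGENCE OF THE SOLUTIONS WITH A RATE, WITHOUT A COMMON UPPER BOUND.**  Functionals `B_n` with common floor `b > 0` on ]0,γ]^ℕ,
`|B_n u − B u| ≤ η_n → 0` on the box, `B` with zeroth moment `M`, `M·γ ≤ 3√3·b`; pins `g_n → g_IR` in ]0,γ]; box solutions `h_n` of `(B_n, g_n)`
and `h` of `(B, g_IR)`.  Then `h_n → h` UNIFORMLY in the scale (`TendstoUniformly`), at the rate `2F_n + √(2γF_n)` of `abs_sub_le_two_regime` —
(E40)'s `tendsto_of_ratio_le` gave this by compactness, without a rate and under a common bound `U` of the `B_n`. [folklore] -/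
theorem tendstoUniformly_of_ratio_le {Bs : ℕ → (ℕ → ℝ) → ℝ} {g : ℕ → ℝ} {ηs : ℕ → ℝ} {hs : ℕ → ℕ → ℝ}
    (hB : ∀ u u' : ℕ → ℝ, SeqBox γ u → SeqBox γ u' → ∀ D : ℝ, (∀ j, |u j - u' j| ≤ D) → |B u - B u'| ≤ M * D)
    (hM : 0 ≤ M) (hgIR : 0 < gIR) (hgIRγ : gIR ≤ γ) (hg0 : ∀ n, 0 < g n) (hgγ : ∀ n, g n ≤ γ) (hb : 0 < b)
    (hlo : ∀ u, SeqBox γ u → b ≤ B u) (hlos : ∀ n u, SeqBox γ u → b ≤ Bs n u) (hsmall : M * γ ≤ 3 * Real.sqrt 3 * b)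
    (hη : ∀ n u, SeqBox γ u → |B u - Bs n u| ≤ ηs n) (hg : Tendsto g atTop (𝓝 gIR)) (hηs : Tendsto ηs atTop (𝓝 0))
    (hh : SeqBox γ h) (hf : MemFlow B gIR h) (hhs : ∀ n, SeqBox γ (hs n)) (hfs : ∀ n, MemFlow (Bs n) (g n) (hs n)) :
    TendstoUniformly hs h atTop := by
  have hγ : 0 < γ := lt_of_lt_of_le hgIR hgIRγ
  set Fs : ℕ → ℝ := fun n => γ ^ 3 / 2 * |1 / gIR ^ 2 - 1 / g n ^ 2| + γ / (3 * Real.sqrt 3 * b) * ηs n with hFs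
  have hFt : Tendsto Fs atTop (𝓝 0) := by
    have := tendsto_forcing (γ := γ) (b := b) hgIR.ne' hg hηs
    refine this.congr fun n => ?_
    simp only [hFs, abs_sub_comm]
  have hrate : Tendsto (fun n => 2 * Fs n + Real.sqrt (2 * γ * Fs n)) atTop (𝓝 0) := by
    have := (hFt.const_mul 2).add ((hFt.const_mul (2 * γ)).sqrt)
    simpa using this
  rw [Metric.tendstoUniformly_iff]
  intro ε hε
  filter_upwards [(tendsto_order.1 hrate).2 ε hε] with n hn j
  rw [Real.dist_eq]
  exact (abs_sub_le_two_regime hB hM hgIR hgIRγ (hg0 n) (hgγ n) hb hlo (hlos n) hsmall (hη n) hh (hhs n) hf (hfs n) j).trans_lt hn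

/-! ## §2 (E47a) specialised to the kink family -/

/-- For `p ∈ ]0,1]`: `|1∕1² − 1∕p²| = 1∕p² − 1`. [folklore] -/
theorem abs_one_sub_inv_sq (hp0 : 0 < p) (hp1 : p ≤ 1) : |1 / (1 : ℝ) ^ 2 - 1 / p ^ 2| = 1 / p ^ 2 - 1 := by
  have : 1 ≤ 1 / p ^ 2 := by
    rw [le_div_iff₀ (by positivity)]
    nlinarith
  rw [abs_sub_comm, one_pow, div_one]
  exact abs_of_nonneg (by linarith)

/-- **(E47a)'S TWO-TERM MODULUS FOR THE KINK FLOW** (`0 ≤ q ≤ 1`, pins `1` and `p ∈ ]0,1]`, box solutions `h, h′`): at every scale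
`(1−q)·|h_j − h′_j| + q·|h_j − h′_j|² ≤ (1∕p² − 1)∕2` (`γ = 1`, `b = 2`, `M = 6√3·q`, `η = 0`, `F = P∕2`). [folklore] -/
theorem upper_two_term_kink (hq0 : 0 ≤ q) (hq1 : q ≤ 1) (hp0 : 0 < p) (hp1 : p ≤ 1) (hh : SeqBox 1 h)
    (hf : MemFlow (fun u : ℕ → ℝ => 2 + 6 * q * max (1 - Real.sqrt 3 * u 0) 0) 1 h) (hh' : SeqBox 1 h')
    (hf' : MemFlow (fun u : ℕ → ℝ => 2 + 6 * q * max (1 - Real.sqrt 3 * u 0) 0) p h') (j : ℕ) :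
    (1 - q) * |h j - h' j| + q * |h j - h' j| ^ 2 ≤ (1 / p ^ 2 - 1) / 2 := by
  have hsmall : 6 * Real.sqrt 3 * q * 1 ≤ 3 * Real.sqrt 3 * 2 := (kink_closed_iff q).2 hq1
  have h0 : ∀ u : ℕ → ℝ, SeqBox 1 u →
      |(2 + 6 * q * max (1 - Real.sqrt 3 * u 0) 0) - (2 + 6 * q * max (1 - Real.sqrt 3 * u 0) 0)| ≤ 0 := fun u _ => by simp
  have hmain := two_term_modulus_zs_closed (γ := 1) (b := 2) (M := 6 * Real.sqrt 3 * q) (η := 0)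
    (B := fun u : ℕ → ℝ => 2 + 6 * q * max (1 - Real.sqrt 3 * u 0) 0)
    (B' := fun u : ℕ → ℝ => 2 + 6 * q * max (1 - Real.sqrt 3 * u 0) 0)
    (zerothMoment_kink hq0) (by positivity) one_pos le_rfl hp0 hp1 two_pos (fun u _ => two_le_kink hq0 u)
    (fun u _ => two_le_kink hq0 u) hsmall h0 hh hh' hf hf' j
  rw [kink_ratio, abs_one_sub_inv_sq hp0 hp1] at hmain
  have e : (1 : ℝ) ^ 3 / 2 * (1 / p ^ 2 - 1) + 1 / (3 * Real.sqrt 3 * 2) * 0 = (1 / p ^ 2 - 1) / 2 := by ring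
  rw [e, div_one] at hmain
  exact hmain

/-- Lipschitz form (`q < 1`): `|h_j − h′_j| ≤ (1∕p² − 1)∕(2(1−q))` — (E38b)'s constant for this instance. [folklore] -/
theorem upper_lipschitz_kink (hq0 : 0 ≤ q) (hq1 : q < 1) (hp0 : 0 < p) (hp1 : p ≤ 1) (hh : SeqBox 1 h)
    (hf : MemFlow (fun u : ℕ → ℝ => 2 + 6 * q * max (1 - Real.sqrt 3 * u 0) 0) 1 h) (hh' : SeqBox 1 h')
    (hf' : MemFlow (fun u : ℕ → ℝ => 2 + 6 * q * max (1 - Real.sqrt 3 * u 0) 0) p h') (j : ℕ) :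
    |h j - h' j| ≤ (1 / p ^ 2 - 1) / (2 * (1 - q)) := by
  have hmain := upper_two_term_kink hq0 hq1.le hp0 hp1 hh hf hh' hf' j
  have hquad : 0 ≤ q * |h j - h' j| ^ 2 := by positivity
  rw [le_div_iff₀ (by linarith)]
  nlinarith

/-- Square-root form (`0 < q ≤ 1`): `|h_j − h′_j| ≤ √((1∕p² − 1)∕(2q))`. [folklore] -/
theorem upper_sqrt_kink (hq0 : 0 < q) (hq1 : q ≤ 1) (hp0 : 0 < p) (hp1 : p ≤ 1) (hh : SeqBox 1 h)
    (hf : MemFlow (fun u : ℕ → ℝ => 2 + 6 * q * max (1 - Real.sqrt 3 * u 0) 0) 1 h) (hh' : SeqBox 1 h')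
    (hf' : MemFlow (fun u : ℕ → ℝ => 2 + 6 * q * max (1 - Real.sqrt 3 * u 0) 0) p h') (j : ℕ) :
    |h j - h' j| ≤ Real.sqrt ((1 / p ^ 2 - 1) / (2 * q)) := by
  have hmain := upper_two_term_kink hq0.le hq1 hp0 hp1 hh hf hh' hf' j
  have hlin : 0 ≤ (1 - q) * |h j - h' j| := mul_nonneg (sub_nonneg.2 hq1) (abs_nonneg _)
  refine Real.le_sqrt_of_sq_le ?_
  rw [le_div_iff₀ (by positivity)]
  nlinarith

/-- AT the threshold (`q = 1`): `|h_j − h′_j| ≤ √((1∕p² − 1)∕2)` — (E47a)'s `√(γF)` for this instance. [folklore] -/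
theorem upper_at_threshold_kink (hp0 : 0 < p) (hp1 : p ≤ 1) (hh : SeqBox 1 h)
    (hf : MemFlow (fun u : ℕ → ℝ => 2 + 6 * 1 * max (1 - Real.sqrt 3 * u 0) 0) 1 h) (hh' : SeqBox 1 h')
    (hf' : MemFlow (fun u : ℕ → ℝ => 2 + 6 * 1 * max (1 - Real.sqrt 3 * u 0) 0) p h') (j : ℕ) :
    |h j - h' j| ≤ Real.sqrt ((1 / p ^ 2 - 1) / 2) := by
  have := upper_sqrt_kink (q := 1) one_pos le_rfl hp0 hp1 hh hf hh' hf' j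
  rwa [mul_one] at this

/-! ## §3 The pinching, regime by regime -/

/-- **LIPSCHITZ REGIME, PINCHED** (`0 ≤ q < 1`, `p ∈ [1∕2,1[`, `P = 1∕p² − 1 ≤ 9(1−q)²`):
`P∕(68(1−q)) ≤ h(1) − h′(1) ≤ sup_j |h_j − h′_j| ≤ P∕(2(1−q))` — the blow-up `1∕(1−q)` of (E38b)'s Lipschitz constant is exact in order. [folklore] -/
theorem pinched_lipschitz_regime (hq0 : 0 ≤ q) (hq1 : q < 1) (hp0 : 1 / 2 ≤ p) (hp1 : p ≤ 1)
    (hreg : 1 / p ^ 2 - 1 ≤ 9 * (1 - q) ^ 2) (hh : SeqBox 1 h)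
    (hf : MemFlow (fun u : ℕ → ℝ => 2 + 6 * q * max (1 - Real.sqrt 3 * u 0) 0) 1 h) (hh' : SeqBox 1 h')
    (hf' : MemFlow (fun u : ℕ → ℝ => 2 + 6 * q * max (1 - Real.sqrt 3 * u 0) 0) p h') :
    (1 / p ^ 2 - 1) / (68 * (1 - q)) ≤ h 1 - h' 1 ∧ ∀ j, |h j - h' j| ≤ (1 / p ^ 2 - 1) / (2 * (1 - q)) :=
  ⟨gap_lipschitz_regime hq0 hq1 hp0 hp1 hreg hh hf hh' hf',
    fun j => upper_lipschitz_kink hq0 hq1 (by linarith) hp1 hh hf hh' hf' j⟩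

/-- **HÖLDER REGIME, PINCHED** (`0 < q ≤ 1`, `p ∈ [1∕2,1[`, `9(1−q)² ≤ P = 1∕p² − 1`):
`√P∕20 ≤ h(1) − h′(1) ≤ sup_j |h_j − h′_j| ≤ √(P∕(2q))` — the square-root branch of the two-term modulus is exact in order. [folklore] -/
theorem pinched_hoelder_regime (hq0 : 0 < q) (hq1 : q ≤ 1) (hp0 : 1 / 2 ≤ p) (hp1 : p ≤ 1)
    (hreg : 9 * (1 - q) ^ 2 ≤ 1 / p ^ 2 - 1) (hh : SeqBox 1 h)
    (hf : MemFlow (fun u : ℕ → ℝ => 2 + 6 * q * max (1 - Real.sqrt 3 * u 0) 0) 1 h) (hh' : SeqBox 1 h')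
    (hf' : MemFlow (fun u : ℕ → ℝ => 2 + 6 * q * max (1 - Real.sqrt 3 * u 0) 0) p h') :
    Real.sqrt (1 / p ^ 2 - 1) / 20 ≤ h 1 - h' 1 ∧ ∀ j, |h j - h' j| ≤ Real.sqrt ((1 / p ^ 2 - 1) / (2 * q)) :=
  ⟨gap_hoelder_regime hq0.le hq1 hp0 hp1 hreg hh hf hh' hf',
    fun j => upper_sqrt_kink hq0 hq1 (by linarith) hp1 hh hf hh' hf' j⟩

/-- **AT THE THRESHOLD, PINCHED** (`q = 1`, `p ∈ [1∕2,1[`, `P = 1∕p² − 1`): `√P∕10 ≤ h(1) − h′(1) ≤ sup_j |h_j − h′_j| ≤ √(P∕2)` — (E47a)'s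
`1∕2`-Hölder modulus `√(γF)` is attained in order by a Markov functional at `bγ² = 2`. [folklore] -/
theorem pinched_at_threshold (hp0 : 1 / 2 ≤ p) (hp1 : p ≤ 1) (hh : SeqBox 1 h)
    (hf : MemFlow (fun u : ℕ → ℝ => 2 + 6 * 1 * max (1 - Real.sqrt 3 * u 0) 0) 1 h) (hh' : SeqBox 1 h')
    (hf' : MemFlow (fun u : ℕ → ℝ => 2 + 6 * 1 * max (1 - Real.sqrt 3 * u 0) 0) p h') :
    Real.sqrt (1 / p ^ 2 - 1) / 10 ≤ h 1 - h' 1 ∧ ∀ j, |h j - h' j| ≤ Real.sqrt ((1 / p ^ 2 - 1) / 2) :=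
  ⟨gap_at_threshold hp0 hp1 hh hf hh' hf', fun j => upper_at_threshold_kink (by linarith) hp1 hh hf hh' hf' j⟩

/-- **AT THE THRESHOLD, PINCHED IN THE FUNCTIONAL DIRECTION** (`q = 1`, pin `1`, `η ∈ [0,3]`): box solutions `h` of the threshold kink flow `κ_1` and `h′`
of its shift `κ_1 + η` ((E47d)) satisfy `√η∕10 ≤ h(1) − h′(1) ≤ sup_j |h_j − h′_j| ≤ √(η∕(6√3))` — (E47a)'s `√(γF)` with `F = γη∕(3√3b) = η∕(6√3)`:
the `1∕2`-Hölder dependence on the FUNCTIONAL is attained in order as well. [folklore] -/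
theorem pinched_functional_at_threshold {η : ℝ} (hη0 : 0 ≤ η) (hη3 : η ≤ 3) (hh : SeqBox 1 h)
    (hf : MemFlow (fun u : ℕ → ℝ => 2 + 6 * 1 * max (1 - Real.sqrt 3 * u 0) 0) 1 h) (hh' : SeqBox 1 h')
    (hf' : MemFlow (fun u : ℕ → ℝ => 2 + η + 6 * 1 * max (1 - Real.sqrt 3 * u 0) 0) 1 h') :
    Real.sqrt η / 10 ≤ h 1 - h' 1 ∧ ∀ j, |h j - h' j| ≤ Real.sqrt (η / (6 * Real.sqrt 3)) := by
  refine ⟨?_, fun j => ?_⟩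
  · have := shift_gap_at_threshold hη0 hη3 hh' hf'
    rwa [← apply_one_eq_of_pin_one (q := 1) zero_le_one le_rfl hh hf] at this
  · have h30 : (0 : ℝ) < Real.sqrt 3 := Real.sqrt_pos.2 (by norm_num)
    have hcrit : 6 * Real.sqrt 3 * 1 * 1 = 3 * Real.sqrt 3 * 2 := by ring
    have hη : ∀ u : ℕ → ℝ, SeqBox 1 u →
        |(2 + 6 * 1 * max (1 - Real.sqrt 3 * u 0) 0) - (2 + η + 6 * 1 * max (1 - Real.sqrt 3 * u 0) 0)| ≤ η := fun u _ => by
      rw [show (2 + 6 * 1 * max (1 - Real.sqrt 3 * u 0) 0) - (2 + η + 6 * 1 * max (1 - Real.sqrt 3 * u 0) 0) = -η by ring,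
        abs_neg, abs_of_nonneg hη0]
    have hlo' : ∀ u : ℕ → ℝ, SeqBox 1 u → 2 ≤ 2 + η + 6 * 1 * max (1 - Real.sqrt 3 * u 0) 0 := fun u _ => by
      linarith [two_le_kink zero_le_one u]
    have := abs_sub_le_sqrt_at_threshold (γ := 1) (b := 2) (M := 6 * Real.sqrt 3 * 1) (η := η)
      (B := fun u : ℕ → ℝ => 2 + 6 * 1 * max (1 - Real.sqrt 3 * u 0) 0)
      (B' := fun u : ℕ → ℝ => 2 + η + 6 * 1 * max (1 - Real.sqrt 3 * u 0) 0)
      (zerothMoment_kink zero_le_one) one_pos le_rfl one_pos le_rfl two_pos (fun u _ => two_le_kink zero_le_one u) hlo' hcrit hη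
      hh hh' hf hf' j
    have e : (1 : ℝ) * (1 ^ 3 / 2 * |1 / 1 ^ 2 - 1 / 1 ^ 2| + 1 / (3 * Real.sqrt 3 * 2) * η) = η / (6 * Real.sqrt 3) := by
      rw [sub_self, abs_zero, mul_zero, zero_add, one_mul]
      field_simp
      ring
    rwa [e] at this

/-! ## §4 The Hölder exponent at the threshold is exactly `1∕2` -/

/-- **NO HÖLDER EXPONENT ABOVE `1∕2` AT THE THRESHOLD**: for every `K` and every `α > 1∕2` there are a pin `p ∈ [1∕2, 1[` and box solutions `h, h′` of
`κ_1` from the pins `1, p` (they exist, (E40)) with `h(1) − h′(1) > K·(1∕p² − 1)^α`. (`K·P^α = K·√P·P^{α−1∕2} < √P∕10` for small `P`.) [folklore] -/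
theorem not_hoelder_above_half (K α : ℝ) (hα : 1 / 2 < α) :
    ∃ p : ℝ, 1 / 2 ≤ p ∧ p < 1 ∧ ∃ h h' : ℕ → ℝ,
      SeqBox 1 h ∧ MemFlow (fun u : ℕ → ℝ => 2 + 6 * 1 * max (1 - Real.sqrt 3 * u 0) 0) 1 h ∧
      SeqBox 1 h' ∧ MemFlow (fun u : ℕ → ℝ => 2 + 6 * 1 * max (1 - Real.sqrt 3 * u 0) 0) p h' ∧
      K * (1 / p ^ 2 - 1) ^ α < h 1 - h' 1 := by
  -- a forcing `P ∈ ]0,3]` with `K·P^α < √P∕10`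
  obtain ⟨P, hP0, hP3, hKP⟩ : ∃ P : ℝ, 0 < P ∧ P ≤ 3 ∧ K * P ^ α < Real.sqrt P / 10 := by
    rcases le_or_gt K 0 with hK | hK
    · refine ⟨3, by norm_num, le_rfl, ?_⟩
      have h1 : K * (3 : ℝ) ^ α ≤ 0 := mul_nonpos_of_nonpos_of_nonneg hK (Real.rpow_nonneg (by norm_num) _)
      have h2 : 0 < Real.sqrt 3 / 10 := by positivity
      linarith
    · set e : ℝ := α - 1 / 2 with he
      have he0 : 0 < e := by rw [he]; linarith
      have hb0 : 0 < 1 / (20 * K) := by positivity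
      set P : ℝ := min 3 ((1 / (20 * K)) ^ (1 / e)) with hPdef
      have hP0 : 0 < P := lt_min (by norm_num) (Real.rpow_pos_of_pos hb0 _)
      refine ⟨P, hP0, min_le_left _ _, ?_⟩
      have hPe : P ^ e ≤ 1 / (20 * K) := by
        calc P ^ e ≤ ((1 / (20 * K)) ^ (1 / e)) ^ e := Real.rpow_le_rpow hP0.le (min_le_right _ _) he0.le
          _ = 1 / (20 * K) := by rw [← Real.rpow_mul hb0.le, one_div_mul_cancel he0.ne', Real.rpow_one]
      have hsplit : P ^ α = Real.sqrt P * P ^ e := by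
        rw [Real.sqrt_eq_rpow, ← Real.rpow_add hP0]
        congr 1
        rw [he]
        ring
      have hsP : 0 < Real.sqrt P := Real.sqrt_pos.2 hP0
      have hle : K * (Real.sqrt P * P ^ e) ≤ Real.sqrt P / 20 := by
        calc K * (Real.sqrt P * P ^ e) = Real.sqrt P * (K * P ^ e) := by ring
          _ ≤ Real.sqrt P * (K * (1 / (20 * K))) :=
              mul_le_mul_of_nonneg_left (mul_le_mul_of_nonneg_left hPe hK.le) hsP.le
          _ = Real.sqrt P / 20 := by field_simp
      rw [hsplit]
      linarith
  obtain ⟨hp0, hp1, hpP⟩ := pin_of_forcing hP0 hP3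
  obtain ⟨h, hh, hf⟩ := exists_solution (q := 1) zero_le_one one_pos le_rfl
  obtain ⟨h', hh', hf'⟩ := exists_solution (q := 1) zero_le_one (by linarith) hp1.le
  refine ⟨_, hp0, hp1, h, h', hh, hf, hh', hf', ?_⟩
  have hgap := gap_at_threshold hp0 hp1.le hh hf hh' hf'
  rw [hpP] at hgap ⊢
  exact hKP.trans_le hgap

/-- BELOW `1∕2` A HÖLDER BOUND HOLDS (`α ≤ 1∕2`, `p ∈ [1∕2,1]`, so `P = 1∕p² − 1 ≤ 3`): `h(1) − h′(1) ≤ 3^{1∕2−α}∕√2 · P^α`, from the upper bound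
`√(P∕2) = P^{1∕2}∕√2` and `P^{1∕2−α} ≤ 3^{1∕2−α}`. [folklore] -/
theorem hoelder_below_half {α : ℝ} (hα : α ≤ 1 / 2) (hp0 : 1 / 2 ≤ p) (hp1 : p ≤ 1) (hh : SeqBox 1 h)
    (hf : MemFlow (fun u : ℕ → ℝ => 2 + 6 * 1 * max (1 - Real.sqrt 3 * u 0) 0) 1 h) (hh' : SeqBox 1 h')
    (hf' : MemFlow (fun u : ℕ → ℝ => 2 + 6 * 1 * max (1 - Real.sqrt 3 * u 0) 0) p h') :
    h 1 - h' 1 ≤ (3 : ℝ) ^ (1 / 2 - α) / Real.sqrt 2 * (1 / p ^ 2 - 1) ^ α := by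
  have hp : 0 < p := by linarith
  set P : ℝ := 1 / p ^ 2 - 1 with hPdef
  have hP0 : 0 ≤ P := by
    have : 1 ≤ 1 / p ^ 2 := by
      rw [le_div_iff₀ (by positivity)]
      nlinarith
    linarith
  have hP3 : P ≤ 3 := by
    have : 1 / p ^ 2 ≤ 4 := by
      rw [div_le_iff₀ (by positivity)]
      nlinarith
    linarith
  have hup := upper_at_threshold_kink hp hp1 hh hf hh' hf' 1
  have h1 : h 1 - h' 1 ≤ Real.sqrt (P / 2) := (le_abs_self _).trans hup
  -- `√(P∕2) = P^{1∕2}∕√2 = P^α · P^{1∕2−α}∕√2 ≤ P^α · 3^{1∕2−α}∕√2`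
  have h2 : Real.sqrt (P / 2) = P ^ α * P ^ (1 / 2 - α) / Real.sqrt 2 := by
    rw [Real.sqrt_div' P zero_le_two, Real.sqrt_eq_rpow P, ← Real.rpow_add' hP0 (by norm_num : α + (1 / 2 - α) ≠ 0)]
    congr 2
    ring
  have h3 : P ^ (1 / 2 - α) ≤ (3 : ℝ) ^ (1 / 2 - α) := Real.rpow_le_rpow hP0 hP3 (by linarith)
  have h4 : P ^ α * P ^ (1 / 2 - α) / Real.sqrt 2 ≤ P ^ α * (3 : ℝ) ^ (1 / 2 - α) / Real.sqrt 2 :=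
    div_le_div_of_nonneg_right (mul_le_mul_of_nonneg_left h3 (Real.rpow_nonneg hP0 _)) (Real.sqrt_nonneg _)
  calc h 1 - h' 1 ≤ Real.sqrt (P / 2) := h1
    _ = P ^ α * P ^ (1 / 2 - α) / Real.sqrt 2 := h2
    _ ≤ P ^ α * (3 : ℝ) ^ (1 / 2 - α) / Real.sqrt 2 := h4
    _ = (3 : ℝ) ^ (1 / 2 - α) / Real.sqrt 2 * P ^ α := by ring

/-- **THE HÖLDER EXPONENT AT THE THRESHOLD IS EXACTLY `1∕2`**: for a real exponent `α`, a bound `h(1) − h′(1) ≤ K·(1∕p² − 1)^α` holds UNIFORMLY over the pins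
`p ∈ [1∕2, 1[` and all box solutions `h, h′` of the threshold kink flow `κ_1` from the pins `1, p`, for SOME constant `K`, if and only if `α ≤ 1∕2`. [folklore] -/
theorem hoelder_exponent_iff (α : ℝ) :
    (∃ K : ℝ, ∀ p : ℝ, 1 / 2 ≤ p → p < 1 → ∀ h h' : ℕ → ℝ,
        SeqBox 1 h → MemFlow (fun u : ℕ → ℝ => 2 + 6 * 1 * max (1 - Real.sqrt 3 * u 0) 0) 1 h →
        SeqBox 1 h' → MemFlow (fun u : ℕ → ℝ => 2 + 6 * 1 * max (1 - Real.sqrt 3 * u 0) 0) p h' →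
        h 1 - h' 1 ≤ K * (1 / p ^ 2 - 1) ^ α) ↔ α ≤ 1 / 2 := by
  constructor
  · rintro ⟨K, hK⟩
    by_contra hα
    obtain ⟨p, hp0, hp1, h, h', hh, hf, hh', hf', hlt⟩ := not_hoelder_above_half K α (not_le.1 hα)
    exact absurd (hK p hp0 hp1 h h' hh hf hh' hf') (not_le.2 hlt)
  · intro hα
    exact ⟨(3 : ℝ) ^ (1 / 2 - α) / Real.sqrt 2, fun p hp0 hp1 h h' hh hf hh' hf' =>
      hoelder_below_half hα hp0 hp1.le hh hf hh' hf'⟩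

/-! ## §5 Above the threshold: the width bound is attained in order -/

/-- **THE WIDTH BOUND IS ATTAINED WITHIN THE FACTOR 3 ALONG (E38c)'S TENT FAMILY** (`γ = 1`, `b = 2`, `M_y = 3√3(1+y)∕y²`, ratio `q_y = (1+y)∕(2y²) ↓ 1`
as `y ↑ 1`): its two box solutions `hSlow`, `hF_y` differ at scale 1 by `(1 − y)∕√3`, while (E47a)'s `abs_sub_le_width_above` bounds every scale by
`W_y = γ(1 − 3√3b∕(M_yγ)) = (1−y)(1+2y)∕(1+y)`: `W_y∕3 ≤ |hSlow 1 − hF_y 1|` and `sup_j |hSlow j − hF_y j| ≤ W_y` — non-uniqueness switches on at `3√3`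
EXACTLY linearly in the ratio. [folklore] -/
theorem width_pinched_tent {y : ℝ} (hy9 : 9 / 10 ≤ y) (hy1 : y < 1) :
    1 * (1 - 3 * Real.sqrt 3 * 2 / (3 * Real.sqrt 3 * (1 + y) / y ^ 2 * 1)) / 3
        ≤ |hSlow 1 - (fun m : ℕ => (1 : ℝ) / Real.sqrt (1 + 2 * (m : ℝ) + (3 / y ^ 2 - 3) * min (m : ℝ) 1)) 1| ∧
      ∀ j, |hSlow j - (fun m : ℕ => (1 : ℝ) / Real.sqrt (1 + 2 * (m : ℝ) + (3 / y ^ 2 - 3) * min (m : ℝ) 1)) j|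
        ≤ 1 * (1 - 3 * Real.sqrt 3 * 2 / (3 * Real.sqrt 3 * (1 + y) / y ^ 2 * 1)) := by
  have hy0 : 0 < y := by linarith
  have h30 : 0 < Real.sqrt 3 := Real.sqrt_pos.2 (by norm_num)
  have h33 : Real.sqrt 3 ^ 2 = 3 := Real.sq_sqrt (by norm_num)
  have eW : 1 * (1 - 3 * Real.sqrt 3 * 2 / (3 * Real.sqrt 3 * (1 + y) / y ^ 2 * 1)) = (1 - y) * (1 + 2 * y) / (1 + y) := by
    field_simp
    ring
  refine ⟨?_, fun j => ?_⟩
  · -- scale 1: `hSlow 1 = 1∕√3`, `hF_y 1 = y∕√3`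
    have h1 : hSlow 1 = 1 / Real.sqrt 3 := by
      rw [eq_div_iff h30.ne']
      linarith [sqrt3_mul_hSlow_one, mul_comm (Real.sqrt 3) (hSlow 1)]
    have h2 : (fun m : ℕ => (1 : ℝ) / Real.sqrt (1 + 2 * (m : ℝ) + (3 / y ^ 2 - 3) * min (m : ℝ) 1)) 1 = y / Real.sqrt 3 := by
      have := hF_succ y 0
      rw [Nat.zero_add, Nat.cast_zero, mul_zero, add_zero] at this
      rw [this, Real.sqrt_div' 3 (sq_nonneg y), Real.sqrt_sq hy0.le]
      field_simp
    rw [h1, h2, show 1 / Real.sqrt 3 - y / Real.sqrt 3 = (1 - y) / Real.sqrt 3 by ring,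
      abs_of_nonneg (div_nonneg (by linarith) h30.le), eW, div_div, div_le_div_iff₀ (by positivity) h30]
    -- `(1−y)(1+2y)·√3 ≤ (1−y)·((1+y)·3)`: `√3(1+2y) ≤ 3(1+y)` since `√3 ≤ 7∕4`
    have hs : Real.sqrt 3 ≤ 7 / 4 := by nlinarith
    nlinarith [mul_nonneg (sub_nonneg.2 hy1.le) (by nlinarith : (0 : ℝ) ≤ 3 * (1 + y) - Real.sqrt 3 * (1 + 2 * y))]
  · have hlarge : 3 * Real.sqrt 3 * 2 ≤ 3 * Real.sqrt 3 * (1 + y) / y ^ 2 * 1 := by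
      rw [mul_one, le_div_iff₀ (by positivity)]
      nlinarith [mul_pos h30 hy0]
    exact abs_sub_le_width_above (γ := 1) (b := 2) (M := 3 * Real.sqrt 3 * (1 + y) / y ^ 2) (gIR := 1)
      (B := fun u => (fun x : ℝ => (2 : ℝ) + max (3 / y ^ 2 - 3 - 3 * (1 + y) / y ^ 2 * |Real.sqrt 3 * x - y|) 0) (u 0))
      (zerothMoment_tentφ hy0 1) one_pos le_rfl two_pos (fun u _ => two_le_tentφ y (u 0)) hlarge seqBox_hSlow (seqBox_hF hy0 hy1.le)
      (memFlow_hSlow_tentφ hy0 hy9 hy1.le) (memFlow_hF_tentφ hy0 hy9 hy1.le) j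

end Summit.QuantumFields.BalabanUV.Beta.EriceRemainderEnclosureHistoryAutonomyThresholdModulusExact

end
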